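import Literature.NumberTheory.GaloisRepresentations.CompletionCompositum
import Literature.NumberTheory.GaloisRepresentations.PadicAlgebraDegreeOnePlace
import Mathlib.NumberTheory.RamificationInertia.Galois
import Mathlib.FieldTheory.Normal.Closure
import HarnessLib

/-!
# The local degree of a completion of a number field:
# `[F_v : K_{v₀}] = e(v|v₀) · f(v|v₀)`, in particular `[F_v : ℚ_p] = e(v|p) · f(v|p)`

Topic `Literature/NumberTheory/NumberFields`; a *proofs* file (theorems only: no definition, no
named fact). For a finite extension of number fields `F/K`, a finite place `v₀` of `K` and a
place `v` of `F` above it, the completion `F_v` is a finite extension of `K_{v₀}` — through the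
local base-change map `K_{v₀} → F_v` of the
tree (`Literature.NumberTheory.Automorphic.adicCompletionOfLiesOver`, packaged as the instance
`SemiLocal.algebraPlace`) — of degree `[F_v : K_{v₀}] = e(v|v₀) · f(v|v₀)` (Neukirch,
*Algebraic Number Theory*, Ch. II (8.2)–(8.5); Cassels–Fröhlich, Ch. II §10:
`[L_w : K_v] = e f`).

* `finrank_place_eq_ramificationIdx_mul_inertiaDeg_of_isGalois` — the Galois case, read off
  the tree's `[E_w : K_v] = #Stab(w)` (`SemiLocal.finrank_place_eq_card_stabilizer`) and
  Mathlib's `#Stab(𝔭_w) = e · f` (`Ideal.card_stabilizer_eq`);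
* `adicCompletionOfLiesOver_comp`, `isScalarTower_place_tower` — **towers**: for `K ⊆ F ⊆ E` and
  places `w ∣ v ∣ v₀` the local base-change maps compose, `(F_v → E_w) ∘ (K_{v₀} → F_v) =
  (K_{v₀} → E_w)` (both sides are continuous and agree on the dense subfield `K`);
* `finrank_place_eq_ramificationIdx_mul_inertiaDeg` — **the general case**, by passing to a
  Galois closure `E/K` of `F` and dividing the Galois formulas for `E_w/K_{v₀}` and `E_w/F_v`
  by one another, using the multiplicativity of `e`, `f` (Mathlib `Ideal.ramificationIdx_tower`,
  `Ideal.inertiaDeg_tower`) and of degrees in the tower `K_{v₀} ⊆ F_v ⊆ E_w`;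
* over `ℚ`: `finrank_padic_adicCompletion_eq` — for a number field `F`, a prime `p`, a place
  `v ∣ p` and ANY `ℚ_p`-algebra structure on `F_v` with continuous structure map (there is
  exactly one, the tree's `LocalField.adicCompletionPadicAlgebra`): `[F_v : ℚ_p] = e(v|p) ·
  f(v|p)` with `e`, `f` over `ℤ` (Mathlib `Ideal.ramificationIdx ℤ`, `Ideal.inertiaDeg ℤ`);
  also for the canonical structure (`finrank_adicCompletionPadicAlgebra_eq`) and in the older
  spelling `Ideal.ramificationIdx' (p) 𝔭_v * Ideal.inertiaDeg' (p) 𝔭_v`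
  (`finrank_padic_adicCompletion_eq'`) = the local degree `localDegree F v = e_v f_v` of the
  abc-iut cell's `Literature.IUT.LogVolume.FakeAdeleIndex` (its recorded `TODO(general form)`).

## References

* J. Neukirch, *Algebraic Number Theory* (1999), Ch. II (8.2), (8.5), (9.6). [NeukirchANT1999]
* J. W. S. Cassels, A. Fröhlich (eds.), *Algebraic Number Theory* (1967), Ch. II §10,
  Ch. VII §1.1. [CasselsFrohlichANT1967]

Design notes. Statements are for the `K_{v₀}`-structure `SemiLocal.algebraPlace` of the tree;
as there, the number fields of a tower live in one universe, so the `ℚ_p`-statements are for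
`F : Type` (`TODO(general form)`: `F : Type u`). No new definition, instance or named fact.
-/

noncomputable section

open NumberField IsDedekindDomain
open scoped Pointwise
namespace Literature.NumberTheory.NumberFields

open Literature.NumberTheory.Automorphic Literature.NumberTheory.GaloisRepresentations SemiLocal

universe u

section Galois -- the Galois case: `[E_w : K_v] = e(w|v) f(w|v)`

variable {K : Type u} [Field K] [NumberField K] {E : Type u} [Field E] [NumberField E]
  [Algebra K E] {v : HeightOneSpectrum (𝓞 K)}

/-- The stabiliser of a place `w ∣ v` in `Gal(E/K)` is the stabiliser (decomposition group) of
its prime ideal `𝔭_w` (the action on places is the action on primes). [folklore] -/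
private theorem stabilizer_place_eq (w : Place K E v) :
    MulAction.stabilizer (E ≃ₐ[K] E) w =
      MulAction.stabilizer (E ≃ₐ[K] E) ((w : HeightOneSpectrum (𝓞 E)).asIdeal) := by
  ext σ
  simp only [MulAction.mem_stabilizer_iff]
  exact ⟨fun h => congrArg (fun w' : Place K E v => ((w' : HeightOneSpectrum (𝓞 E)).asIdeal)) h,
    fun h => Place.ext (HeightOneSpectrum.ext h)⟩

/-- **Local degree, Galois case.** For a finite Galois extension of number fields `E/K` and
places `w ∣ v`: `[E_w : K_v] = e(w|v) · f(w|v)` — the tree's `[E_w : K_v] = #Stab(w)` and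
Mathlib's `#Stab(𝔭_w) = e f` (`Ideal.card_stabilizer_eq`; in the Galois case all `e(w|v)`,
`f(w|v)` above `v` agree, `Ideal.ramificationIdxIn_eq_ramificationIdx`).
[cite: NeukirchANT1999, Ch. II Prop. (9.6)] [cite: CasselsFrohlichANT1967, Ch. VII §1.1] -/
theorem finrank_place_eq_ramificationIdx_mul_inertiaDeg_of_isGalois [IsGalois K E]
    (w : Place K E v) :
    Module.finrank (v.adicCompletion K) ((w : HeightOneSpectrum (𝓞 E)).adicCompletion E) =
      (w : HeightOneSpectrum (𝓞 E)).asIdeal.ramificationIdx (𝓞 K) *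
        (w : HeightOneSpectrum (𝓞 E)).asIdeal.inertiaDeg (𝓞 K) := by
  set P := (w : HeightOneSpectrum (𝓞 E)).asIdeal
  rw [finrank_place_eq_card_stabilizer w, stabilizer_place_eq w]
  haveI : P.IsPrime := (w : HeightOneSpectrum (𝓞 E)).isPrime
  haveI : v.asIdeal.IsPrime := v.isPrime
  haveI : Finite (𝓞 K ⧸ v.asIdeal) := Ideal.finiteQuotientOfFreeOfNeBot v.asIdeal v.ne_bot
  rw [Ideal.card_stabilizer_eq (G := E ≃ₐ[K] E) v.asIdeal P,
    Ideal.ramificationIdxIn_eq_ramificationIdx v.asIdeal P (E ≃ₐ[K] E),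
    Ideal.inertiaDegIn_eq_inertiaDeg v.asIdeal P (E ≃ₐ[K] E)]

end Galois

section Tower -- towers `K ⊆ F ⊆ E`: the local base-change maps compose

variable {K : Type u} [Field K] [NumberField K] {F : Type u} [Field F] [NumberField F]
  {E : Type u} [Field E] [NumberField E]
  [Algebra K F] [Algebra F E] [Algebra K E] [IsScalarTower K F E]
  {v₀ : HeightOneSpectrum (𝓞 K)}

omit [NumberField K] [NumberField F] [NumberField E] in
/-- A place of `E` above a place of `F` above `v₀` lies above `v₀` (`Ideal.under_under`).
[folklore] -/
private theorem under_eq_of_place (v : Place K F v₀) (w : Place F E v) :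
    (w : HeightOneSpectrum (𝓞 E)).under (𝓞 K) = v₀ := by
  apply HeightOneSpectrum.ext
  rw [HeightOneSpectrum.under_asIdeal, ← Ideal.under_under (B := 𝓞 F),
    ← HeightOneSpectrum.under_asIdeal, ← HeightOneSpectrum.under_asIdeal, w.under_eq,
    v.under_eq]

/-- **The local base-change maps compose in towers**:
`(F_v → E_w) ∘ (K_{v₀} → F_v) = (K_{v₀} → E_w)` for `w ∣ v ∣ v₀` — both sides are continuous
ring homomorphisms agreeing on the dense subfield `K` (the instance hypothesis `𝔭_w ∣ 𝔭_{v₀}`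
holds by `under_eq_of_place`; it is taken as an argument to keep the statement free of the
auxiliary place structure). [cite: CasselsFrohlichANT1967, Ch. II §10] -/
theorem adicCompletionOfLiesOver_comp (v : Place K F v₀) (w : Place F E v)
    [(w : HeightOneSpectrum (𝓞 E)).asIdeal.LiesOver v₀.asIdeal] :
    (adicCompletionOfLiesOver F E (v : HeightOneSpectrum (𝓞 F))
          (w : HeightOneSpectrum (𝓞 E))).comp
        (adicCompletionOfLiesOver K F v₀ (v : HeightOneSpectrum (𝓞 F))) =
      adicCompletionOfLiesOver K E v₀ (w : HeightOneSpectrum (𝓞 E)) := by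
  apply DFunLike.coe_injective
  refine Literature.NumberTheory.Automorphic.HeightOneSpectrum.adicCompletion.ext_of_coe
    (L := K) v₀ ?_ ?_ fun x => ?_
  · exact (continuous_adicCompletionOfLiesOver F E (v : HeightOneSpectrum (𝓞 F))
        (w : HeightOneSpectrum (𝓞 E))).comp
      (continuous_adicCompletionOfLiesOver K F v₀ (v : HeightOneSpectrum (𝓞 F)))
  · exact continuous_adicCompletionOfLiesOver K E v₀ (w : HeightOneSpectrum (𝓞 E))
  · change adicCompletionOfLiesOver F E (v : HeightOneSpectrum (𝓞 F))
          (w : HeightOneSpectrum (𝓞 E))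
        (adicCompletionOfLiesOver K F v₀ (v : HeightOneSpectrum (𝓞 F))
          (x : v₀.adicCompletion K)) =
      adicCompletionOfLiesOver K E v₀ (w : HeightOneSpectrum (𝓞 E))
        (x : v₀.adicCompletion K)
    rw [adicCompletionOfLiesOver_coe, adicCompletionOfLiesOver_coe,
      adicCompletionOfLiesOver_coe, ← IsScalarTower.algebraMap_apply K F E]

/-- The local base-change structures `K_{v₀} → F_v → E_w`, `K_{v₀} → E_w` form a scalar tower
(`SemiLocal.algebraPlace` for `F_v/K_{v₀}` and `E_w/F_v`; the `K_{v₀}`-structure of `E_w` is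
`adicCompletionOfLiesOver K E v₀ w`, i.e. `SemiLocal.algebraPlace` of `w` as a place above `v₀`;
Cassels–Fröhlich II §10: `K_v ⊆ L_w` functorially). [cite: CasselsFrohlichANT1967, Ch. II §10] -/
theorem isScalarTower_place_tower (v : Place K F v₀) (w : Place F E v)
    [(w : HeightOneSpectrum (𝓞 E)).asIdeal.LiesOver v₀.asIdeal] :
    letI : Algebra (v₀.adicCompletion K) ((w : HeightOneSpectrum (𝓞 E)).adicCompletion E) :=
      (adicCompletionOfLiesOver K E v₀ (w : HeightOneSpectrum (𝓞 E))).toAlgebra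
    IsScalarTower (v₀.adicCompletion K) ((v : HeightOneSpectrum (𝓞 F)).adicCompletion F)
      ((w : HeightOneSpectrum (𝓞 E)).adicCompletion E) := by
  letI : Algebra (v₀.adicCompletion K) ((w : HeightOneSpectrum (𝓞 E)).adicCompletion E) :=
    (adicCompletionOfLiesOver K E v₀ (w : HeightOneSpectrum (𝓞 E))).toAlgebra
  refine IsScalarTower.of_algebraMap_eq fun x => ?_
  change adicCompletionOfLiesOver K E v₀ (w : HeightOneSpectrum (𝓞 E)) x =
    adicCompletionOfLiesOver F E (v : HeightOneSpectrum (𝓞 F)) (w : HeightOneSpectrum (𝓞 E))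
      (adicCompletionOfLiesOver K F v₀ (v : HeightOneSpectrum (𝓞 F)) x)
  have h := congrArg (fun f => f x) (adicCompletionOfLiesOver_comp v w)
  simp only [RingHom.coe_comp, Function.comp_apply] at h
  exact h.symm

end Tower

/-! ### The general case: `[F_v : K_{v₀}] = e(v|v₀) f(v|v₀)` -/

section General

variable {K : Type u} [Field K] [NumberField K] {F : Type u} [Field F] [NumberField F]
  [Algebra K F] {v₀ : HeightOneSpectrum (𝓞 K)}

/-- Auxiliary form of the general case: if `F` embeds in a finite Galois extension `E/K` (of the
same universe), then `[F_v : K_{v₀}] = e(v|v₀) f(v|v₀)`.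
[cite: NeukirchANT1999, Ch. II Prop. (8.5)] -/
theorem finrank_place_eq_ramificationIdx_mul_inertiaDeg_aux (E : Type u) [Field E]
    [NumberField E] [Algebra F E] [Algebra K E] [IsScalarTower K F E] [IsGalois K E]
    (v : Place K F v₀) :
    Module.finrank (v₀.adicCompletion K) ((v : HeightOneSpectrum (𝓞 F)).adicCompletion F) =
      (v : HeightOneSpectrum (𝓞 F)).asIdeal.ramificationIdx (𝓞 K) *
        (v : HeightOneSpectrum (𝓞 F)).asIdeal.inertiaDeg (𝓞 K) := by
  haveI : Normal F E := Normal.tower_top_of_normal K F E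
  haveI : IsGalois F E := {}
  obtain ⟨w⟩ := (Place.nonempty : Nonempty (Place F E (v : HeightOneSpectrum (𝓞 F))))
  -- the `K_{v₀}`-structure of `E_w` (`w` as a place above `v₀`), the tower of completions
  haveI : (w : HeightOneSpectrum (𝓞 E)).asIdeal.LiesOver v₀.asIdeal :=
    Place.liesOver (⟨(w : HeightOneSpectrum (𝓞 E)), under_eq_of_place v w⟩ : Place K E v₀)
  letI : Algebra (v₀.adicCompletion K) ((w : HeightOneSpectrum (𝓞 E)).adicCompletion E) :=
    (adicCompletionOfLiesOver K E v₀ (w : HeightOneSpectrum (𝓞 E))).toAlgebra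
  haveI := isScalarTower_place_tower v w
  haveI : (w : HeightOneSpectrum (𝓞 E)).asIdeal.LiesOver (v : HeightOneSpectrum (𝓞 F)).asIdeal :=
    Place.liesOver w
  haveI : (w : HeightOneSpectrum (𝓞 E)).asIdeal.IsPrime := (w : HeightOneSpectrum (𝓞 E)).isPrime
  -- the Galois formulas for `E_w / K_{v₀}`, `E_w / F_v`; multiplicativity of degrees, `e`, `f`
  have hK : Module.finrank (v₀.adicCompletion K)
      ((w : HeightOneSpectrum (𝓞 E)).adicCompletion E) =
        (w : HeightOneSpectrum (𝓞 E)).asIdeal.ramificationIdx (𝓞 K) *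
          (w : HeightOneSpectrum (𝓞 E)).asIdeal.inertiaDeg (𝓞 K) :=
    finrank_place_eq_ramificationIdx_mul_inertiaDeg_of_isGalois
      (⟨(w : HeightOneSpectrum (𝓞 E)), under_eq_of_place v w⟩ : Place K E v₀)
  have hF := finrank_place_eq_ramificationIdx_mul_inertiaDeg_of_isGalois w
  have htower := Module.finrank_mul_finrank (v₀.adicCompletion K)
    ((v : HeightOneSpectrum (𝓞 F)).adicCompletion F)
    ((w : HeightOneSpectrum (𝓞 E)).adicCompletion E)
  have he := Ideal.ramificationIdx_tower (R := 𝓞 K) (v : HeightOneSpectrum (𝓞 F)).asIdeal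
    (w : HeightOneSpectrum (𝓞 E)).asIdeal
  have hf := Ideal.inertiaDeg_tower (R := 𝓞 K) (v : HeightOneSpectrum (𝓞 F)).asIdeal
    (w : HeightOneSpectrum (𝓞 E)).asIdeal
  set Pv := (v : HeightOneSpectrum (𝓞 F)).asIdeal
  set Pw := (w : HeightOneSpectrum (𝓞 E)).asIdeal
  have hpos : 0 < Pw.ramificationIdx (𝓞 F) * Pw.inertiaDeg (𝓞 F) :=
    Nat.mul_pos (Ideal.ramificationIdx_pos _ _) (Ideal.inertiaDeg_pos _ _)
  apply Nat.eq_of_mul_eq_mul_right hpos -- `[F_v:K_{v₀}]·(e_w f_w) = [E_w:K_{v₀}] = …`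
  calc Module.finrank (v₀.adicCompletion K) ((v : HeightOneSpectrum (𝓞 F)).adicCompletion F) *
        (Pw.ramificationIdx (𝓞 F) * Pw.inertiaDeg (𝓞 F))
      = Pw.ramificationIdx (𝓞 K) * Pw.inertiaDeg (𝓞 K) := by rw [← hF, htower, hK]
    _ = Pv.ramificationIdx (𝓞 K) * Pv.inertiaDeg (𝓞 K) *
        (Pw.ramificationIdx (𝓞 F) * Pw.inertiaDeg (𝓞 F)) := by rw [he, hf]; ring

/-- **The local degree of a completion.** For a finite extension of number fields `F/K`, a
finite place `v₀` of `K` and a place `v` of `F` above `v₀`, the completion `F_v` has degree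
`[F_v : K_{v₀}] = e(v|v₀) · f(v|v₀)` (ramification index times residue degree) over `K_{v₀}`,
for the local base-change structure `SemiLocal.algebraPlace`. Proof: pass to the Galois
closure of `F/K`. [cite: NeukirchANT1999, Ch. II Prop. (8.5)]
[cite: CasselsFrohlichANT1967, Ch. II §10] -/
theorem finrank_place_eq_ramificationIdx_mul_inertiaDeg (v : Place K F v₀) :
    Module.finrank (v₀.adicCompletion K) ((v : HeightOneSpectrum (𝓞 F)).adicCompletion F) =
      (v : HeightOneSpectrum (𝓞 F)).asIdeal.ramificationIdx (𝓞 K) *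
        (v : HeightOneSpectrum (𝓞 F)).asIdeal.inertiaDeg (𝓞 K) := by
  -- the Galois closure `E` of `F/K` inside an algebraic closure of `F`
  let E : Type u := IntermediateField.normalClosure K F (AlgebraicClosure F)
  haveI : IsGalois K E := {}
  haveI : NumberField E := NumberField.of_module_finite K E
  exact finrank_place_eq_ramificationIdx_mul_inertiaDeg_aux E v

/-- The same for a place `v` of `F` and the place `v.under (𝓞 K)` of `K` below it.
[cite: NeukirchANT1999, Ch. II Prop. (8.5)] -/
theorem finrank_under_eq_ramificationIdx_mul_inertiaDeg (v : HeightOneSpectrum (𝓞 F)) :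
    letI : Algebra ((v.under (𝓞 K)).adicCompletion K) (v.adicCompletion F) :=
      algebraPlace (⟨v, rfl⟩ : Place K F (v.under (𝓞 K)))
    Module.finrank ((v.under (𝓞 K)).adicCompletion K) (v.adicCompletion F) =
      v.asIdeal.ramificationIdx (𝓞 K) * v.asIdeal.inertiaDeg (𝓞 K) :=
  finrank_place_eq_ramificationIdx_mul_inertiaDeg (⟨v, rfl⟩ : Place K F (v.under (𝓞 K)))

end General

/-! ### Over `ℚ`: `[F_v : ℚ_p] = e(v|p) f(v|p)` -/

section Padic

open Literature.NumberTheory.GaloisRepresentations.LocalField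

variable {F : Type} [Field F] [NumberField F]

/-- The ramification index of a prime `q` of `𝓞 F` over `𝓞 ℚ` is its ramification index over
`ℤ` (`ℤ → 𝓞 ℚ` is onto, so the two extended ideals in `(𝓞 F)_q` coincide). Also proved, with
the same argument, as `ramificationIdx_ringOfIntegers_rat_eq_int` in
`Literature.Barriers.BirchSwinnertonDyer.DescentDefectUnboundedMatsunoLemma42Proofs`;
re-derived here to keep this file's imports inside `NumberTheory`. [folklore] -/
private theorem ramificationIdx_ringOfIntegersRat_eq_int (q : Ideal (𝓞 F)) :
    q.ramificationIdx (𝓞 ℚ) = q.ramificationIdx ℤ := by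
  by_cases hq : q.IsPrime
  · rw [Ideal.ramificationIdx_def, Ideal.ramificationIdx_def]
    have hsurj : Function.Surjective (algebraMap ℤ (𝓞 ℚ)) :=
      Rat.int_algebraMap_surjective _
    have hφ : algebraMap ℤ (Localization.AtPrime q) =
        (algebraMap (𝓞 ℚ) (Localization.AtPrime q)).comp (algebraMap ℤ (𝓞 ℚ)) :=
      RingHom.ext_int _ _
    have hunder : q.under ℤ = (q.under (𝓞 ℚ)).comap (algebraMap ℤ (𝓞 ℚ)) := by
      rw [Ideal.under_def, Ideal.under_def, Ideal.comap_comap, ← RingHom.ext_int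
        (algebraMap ℤ (𝓞 F)) ((algebraMap (𝓞 ℚ) (𝓞 F)).comp (algebraMap ℤ (𝓞 ℚ)))]
    have hI : (q.under ℤ).map (algebraMap ℤ (Localization.AtPrime q)) =
        (q.under (𝓞 ℚ)).map (algebraMap (𝓞 ℚ) (Localization.AtPrime q)) := by
      rw [hunder, hφ, ← Ideal.map_map, Ideal.map_comap_of_surjective _ hsurj]
    rw [hI]
  · rw [Ideal.ramificationIdx_of_not_isPrime q _ hq,
      Ideal.ramificationIdx_of_not_isPrime q _ hq]

/-- A maximal ideal of `𝓞 ℚ` has residue degree `1` over `ℤ` (`ℤ/(p) → 𝓞 ℚ/𝔭` is onto,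
hence an isomorphism of fields). [folklore] -/
private theorem inertiaDeg_ringOfIntegersRat_int_eq_one (Q : Ideal (𝓞 ℚ)) [Q.IsMaximal] :
    Q.inertiaDeg ℤ = 1 := by
  haveI : (Q.under ℤ).IsMaximal := Ideal.IsMaximal.under ℤ Q
  rw [← Ideal.inertiaDeg'_eq_inertiaDeg (Q.under ℤ) Q, Ideal.inertiaDeg'_algebraMap]
  letI : Field (ℤ ⧸ Q.under ℤ) := Ideal.Quotient.field _
  letI : Field (𝓞 ℚ ⧸ Q) := Ideal.Quotient.field _
  have hsurj : Function.Surjective (algebraMap (ℤ ⧸ Q.under ℤ) (𝓞 ℚ ⧸ Q)) := by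
    intro y
    obtain ⟨y, rfl⟩ := Ideal.Quotient.mk_surjective y
    obtain ⟨x, rfl⟩ := Rat.int_algebraMap_surjective (𝓞 ℚ) y
    exact ⟨Ideal.Quotient.mk _ x, rfl⟩
  have e : (ℤ ⧸ Q.under ℤ) ≃ₗ[ℤ ⧸ Q.under ℤ] (𝓞 ℚ ⧸ Q) :=
    LinearEquiv.ofBijective (Algebra.linearMap (ℤ ⧸ Q.under ℤ) (𝓞 ℚ ⧸ Q))
      ⟨(algebraMap (ℤ ⧸ Q.under ℤ) (𝓞 ℚ ⧸ Q)).injective, hsurj⟩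
  rw [← e.finrank_eq, Module.finrank_self]

/-- The residue degree of a maximal ideal `q` of `𝓞 F` over `𝓞 ℚ` is its residue degree over
`ℤ` (multiplicativity in the tower `ℤ → 𝓞 ℚ → 𝓞 F` and the previous lemma). [folklore] -/
private theorem inertiaDeg_ringOfIntegersRat_eq_int (q : Ideal (𝓞 F)) [q.IsMaximal] :
    q.inertiaDeg (𝓞 ℚ) = q.inertiaDeg ℤ := by
  haveI : (q.under (𝓞 ℚ)).IsMaximal := Ideal.IsMaximal.under (𝓞 ℚ) q
  rw [Ideal.inertiaDeg_tower (R := ℤ) (q.under (𝓞 ℚ)) q,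
    inertiaDeg_ringOfIntegersRat_int_eq_one, one_mul]

variable (p : ℕ) [Fact p.Prime] (v : HeightOneSpectrum (𝓞 F))

/-- **The local degree of `F_v / ℚ_p`.** For a number field `F`, a rational prime `p`, a place
`v ∣ p` of `F`, and ANY `ℚ_p`-algebra structure on the completion `F_v` with continuous
structure map (there is exactly one, `LocalField.eq_algebraMap_adicCompletionPadicAlgebra`):
`[F_v : ℚ_p] = e(v|p) · f(v|p)`, ramification index and residue degree of `𝔭_v` over `ℤ`.
Proof: the structure map is the local base change `ℚ_{(p)} → F_v` precomposed with Mathlib's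
`ℚ_p ≃ ℚ_{(p)}` (`Rat.HeightOneSpectrum.adicCompletion.padicEquiv`), so this is
`finrank_place_eq_ramificationIdx_mul_inertiaDeg` for `F/ℚ`.
[cite: NeukirchANT1999, Ch. II Prop. (8.5)] [cite: CasselsFrohlichANT1967, Ch. II §10] -/
theorem finrank_padic_adicCompletion_eq (hv : ((p : ℕ) : 𝓞 F) ∈ v.asIdeal)
    [Algebra ℚ_[p] (v.adicCompletion F)]
    (hc : Continuous (algebraMap ℚ_[p] (v.adicCompletion F))) :
    Module.finrank ℚ_[p] (v.adicCompletion F) =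
      v.asIdeal.ramificationIdx ℤ * v.asIdeal.inertiaDeg ℤ := by
  -- the place of `ℚ` below `v`; `primesEquiv v₀ = p`, so `ℚ_{v₀} ≃ ℚ_p`
  set v₀ : HeightOneSpectrum (𝓞 ℚ) := v.under (𝓞 ℚ)
  have hv₀ : ((p : ℕ) : 𝓞 ℚ) ∈ v₀.asIdeal := natCast_mem_under p v hv
  haveI : v.asIdeal.LiesOver v₀.asIdeal := ⟨rfl⟩
  haveI : v.asIdeal.IsMaximal := v.isMaximal
  obtain rfl : ((Rat.HeightOneSpectrum.primesEquiv v₀ : Nat.Primes) : ℕ) = p :=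
    primesEquiv_eq_of_natCast_mem p v₀ hv₀
  let e := Rat.HeightOneSpectrum.adicCompletion.padicEquiv v₀
  -- the local base change `ι : ℚ_{v₀} → F_v` and the `ℚ_{v₀}`-structure it defines
  let ι := adicCompletionOfLiesOver ℚ F v₀ v
  letI algι : Algebra (v₀.adicCompletion ℚ) (v.adicCompletion F) :=
    algebraPlace (⟨v, rfl⟩ : Place ℚ F v₀)
  -- `ι ∘ e⁻¹` and the given structure map are continuous, hence both THE canonical map
  have h1 : ι.comp (e.symm : _ ≃A[ℚ] _).toRingEquiv.toRingHom =
      (letI := adicCompletionPadicAlgebra v _ hv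
       algebraMap ℚ_[(Rat.HeightOneSpectrum.primesEquiv v₀ : ℕ)] (v.adicCompletion F)) :=
    eq_algebraMap_adicCompletionPadicAlgebra v _ hv _
      ((continuous_adicCompletionOfLiesOver ℚ F v₀ v).comp e.symm.continuous)
  have h2 : algebraMap ℚ_[(Rat.HeightOneSpectrum.primesEquiv v₀ : ℕ)] (v.adicCompletion F) =
      (letI := adicCompletionPadicAlgebra v _ hv
       algebraMap ℚ_[(Rat.HeightOneSpectrum.primesEquiv v₀ : ℕ)] (v.adicCompletion F)) :=
    eq_algebraMap_adicCompletionPadicAlgebra v _ hv _ hc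
  -- transfer of the degree along `e`
  have hc' : (algebraMap ℚ_[(Rat.HeightOneSpectrum.primesEquiv v₀ : ℕ)]
          (v.adicCompletion F)).comp (e : _ ≃A[ℚ] _).toRingEquiv.toRingHom =
      (RingEquiv.refl (v.adicCompletion F)).toRingHom.comp
        (algebraMap (v₀.adicCompletion ℚ) (v.adicCompletion F)) := by
    rw [h2.trans h1.symm]
    refine RingHom.ext fun x => ?_
    change ι (e.symm (e x)) = ι x
    rw [ContinuousAlgEquiv.symm_apply_apply]
  rw [← Algebra.finrank_eq_of_equiv_equiv (e : _ ≃A[ℚ] _).toRingEquiv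
      (RingEquiv.refl (v.adicCompletion F)) hc',
    ← ramificationIdx_ringOfIntegersRat_eq_int, ← inertiaDeg_ringOfIntegersRat_eq_int]
  exact finrank_place_eq_ramificationIdx_mul_inertiaDeg (⟨v, rfl⟩ : Place ℚ F v₀)

/-- The same for the tree's canonical structure `LocalField.adicCompletionPadicAlgebra`
(THE unique continuous `ℚ_p → F_v`). [cite: NeukirchANT1999, Ch. II Prop. (8.5)] -/
theorem finrank_adicCompletionPadicAlgebra_eq (hv : ((p : ℕ) : 𝓞 F) ∈ v.asIdeal) :
    letI := adicCompletionPadicAlgebra v p hv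
    Module.finrank ℚ_[p] (v.adicCompletion F) =
      v.asIdeal.ramificationIdx ℤ * v.asIdeal.inertiaDeg ℤ :=
  letI := adicCompletionPadicAlgebra v p hv
  finrank_padic_adicCompletion_eq p v hv (continuous_algebraMap_adicCompletionPadicAlgebra v p hv)

/-- `𝔭_v` lies over `(p) ⊆ ℤ` when `p ∈ 𝔭_v`. [folklore] -/
private theorem liesOver_span_of_natCast_mem (hv : ((p : ℕ) : 𝓞 F) ∈ v.asIdeal) :
    v.asIdeal.LiesOver (Ideal.span {(p : ℤ)}) := by
  have hp : (p : ℤ) ≠ 0 := Int.natCast_ne_zero.mpr (Fact.out : p.Prime).ne_zero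
  have hprime : (Ideal.span {(p : ℤ)}).IsPrime :=
    (Ideal.span_singleton_prime hp).mpr (Nat.prime_iff_prime_int.mp Fact.out)
  have hmax : (Ideal.span {(p : ℤ)}).IsMaximal := hprime.isMaximal (by simpa using hp)
  refine ⟨hmax.eq_of_le (Ideal.comap_ne_top _ v.isMaximal.ne_top) ?_⟩
  rw [Ideal.span_le, Set.singleton_subset_iff]
  change algebraMap ℤ (𝓞 F) (p : ℤ) ∈ v.asIdeal
  simpa using hv

/-- **`[F_v : ℚ_p] = e_v f_v` in the older spelling** `Ideal.ramificationIdx' (p) 𝔭_v`,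
`Ideal.inertiaDeg' (p) 𝔭_v` over `(p) ⊆ ℤ` — the form of the local degree
`Literature.IUT.LogVolume.localDegree F v = ramIdx F v * resDeg F v` of the abc-iut cell's
`FakeAdeleIndex` (its `TODO(general form)`), for any continuous `ℚ_p`-structure and `F : Type`.
[cite: NeukirchANT1999, Ch. II Prop. (8.5)] -/
theorem finrank_padic_adicCompletion_eq' (hv : ((p : ℕ) : 𝓞 F) ∈ v.asIdeal)
    [Algebra ℚ_[p] (v.adicCompletion F)]
    (hc : Continuous (algebraMap ℚ_[p] (v.adicCompletion F))) :
    Module.finrank ℚ_[p] (v.adicCompletion F) =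
      Ideal.ramificationIdx' (Ideal.span {(p : ℤ)}) v.asIdeal *
        Ideal.inertiaDeg' (Ideal.span {(p : ℤ)}) v.asIdeal := by
  have hp : (p : ℤ) ≠ 0 := Int.natCast_ne_zero.mpr (Fact.out : p.Prime).ne_zero
  haveI : v.asIdeal.IsMaximal := v.isMaximal
  haveI := liesOver_span_of_natCast_mem p v hv
  haveI : (Ideal.span {(p : ℤ)}).IsMaximal :=
    ((Ideal.span_singleton_prime hp).mpr (Nat.prime_iff_prime_int.mp Fact.out)).isMaximal
      (by simpa using hp)
  rw [Ideal.ramificationIdx'_eq_ramificationIdx (Ideal.span {(p : ℤ)}) v.asIdeal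
      (by simpa using hp), Ideal.inertiaDeg'_eq_inertiaDeg (Ideal.span {(p : ℤ)}) v.asIdeal]
  exact finrank_padic_adicCompletion_eq p v hv hc

end Padic

end Literature.NumberTheory.NumberFields

end
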